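import Literature.NumberTheory.Sieve.FordMaynardFragmentationTzeroPrep
import Literature.NumberTheory.Sieve.FordMaynardLambdaVec
import HarnessLib

/-!
# Ford–Maynard, Theorem 6.4: (TypeI-f) implies the one-block fragmentation identity (Tzero)

Everything here is PROVED. Fourth file towards Theorem 6.4 of K. Ford, J. Maynard,
*On the theory of prime producing sieves* (arXiv:2407.14368). We prove the identity (Tzero) of
§6.1: for `f ∈ 𝔉*_η(γ)` (symmetric, bounded, supported on vectors with entries `≥ η` summing to
`1`, satisfying (TypeI-f)), every `y ∈ ℝ^r`, every slice total `t` and `K ≥ ⌊1/η⌋`,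

  `T_K(y; t) := ∑_{k=1}^{K} (1/k!) ∫_{u ∈ Δ_k(t)} (𝓛_2(u) − 𝓛_{1−γ}(u)) f(y,u)/(u₁⋯u_k) du = 0`

(`MemTypeIStar.oneBlockFrag_eq_zero`; `𝓛_2` plays the role of `𝓛_∞`, all sums of entries being
`≤ 1 < 2`). Ford–Maynard expand `𝓛_∞ − 𝓛_{1−γ}` over set partitions, symmetrise, and apply
(TypeI-f) to the block of total `≥ 1 − γ`. We organise the same computation through the
commutative convolution algebra: `𝓛_2 − 𝓛_c = ∑_j w_j (N_2^{⋆j} − N_c^{⋆j})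
= ∑_j w_j ∑_i (N_c^{⋆i} ⋆ N_2^{⋆(j−1−i)}) ⋆ (N_2 − N_c)` (telescoping), and for every product
`P = N_c^{⋆i} ⋆ N_2^{⋆i'}` the functional `Φ_K(P ⋆ (N_2 − N_c)) = ∑_k (1/k!) ∫_{Δ_k} f(y,·)/∏ · (P ⋆ M)`
vanishes (`phi_sconv_sub_eq_zero`): by the two-block symmetrisation
(`sliceIntegral_symm_sconv`) and the two-block Fubini formula (`sliceIntegral_append`) it is an
integral, over the first block `v`, of `P(v)/∏v` times a partial sum of (TypeI-f) at `(y, v)`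
(the factor `N_2 − N_c` of the second block being `𝟙[its total ≥ 1 − γ]`, exactly the range where
(TypeI-f) applies), plus the boundary term `P(∅) ·` (TypeI-f at `y`).

## References

* K. Ford, J. Maynard, *On the theory of prime producing sieves*, arXiv:2407.14368 (2024), §6.1,
  proof of Theorem 6.4, display (Tzero) and the paragraph following it. [FordMaynard2024PrimeSieves]
-/

noncomputable section

open MeasureTheory Finset Literature.Combinatorics.Enumerative

namespace Literature.NumberTheory.Sieve.FordMaynard

/-! ### Two general tools -/

/-- Finite additivity of slice integrals, with hypotheses only on the summands that occur.
[folklore] -/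
theorem sliceIntegral_finset_sum' {ι : Type*} (T : Finset ι) (d : ℕ) (w : ℝ)
    (G : ι → (Fin d → ℝ) → ℝ) (hm : ∀ i ∈ T, Measurable (G i)) {C : ℝ}
    (hb : ∀ i ∈ T, ∀ v, |G i v| ≤ C) :
    sliceIntegral d w (fun v => ∑ i ∈ T, G i v) = ∑ i ∈ T, sliceIntegral d w (G i) := by
  classical
  have key := sliceIntegral_finset_sum T d w (fun i v => if i ∈ T then G i v else 0)
    (fun i => by
      by_cases hi : i ∈ T
      · simp only [hi, if_true]; exact hm i hi
      · simp only [hi, if_false]; exact measurable_const)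
    (C := max C 0) (fun i v => by
      by_cases hi : i ∈ T
      · simp only [hi, if_true]; exact (hb i hi v).trans (le_max_left _ _)
      · simp only [hi, if_false, abs_zero]; exact le_max_right _ _)
  have h1 : (fun v => ∑ i ∈ T, if i ∈ T then G i v else 0) = fun v => ∑ i ∈ T, G i v := by
    funext v
    exact Finset.sum_congr rfl fun i hi => if_pos hi
  rw [h1] at key
  rw [key]
  exact Finset.sum_congr rfl fun i hi => by simp only [hi, if_true]

/-- `∑_{b<M} X(b+1) = ∑_{d=1}^{M} X(d)`. [folklore] -/
theorem sum_range_succ_shift (M : ℕ) (X : ℕ → ℝ) :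
    ∑ b ∈ Finset.range M, X (b + 1) = ∑ d ∈ Finset.Icc 1 M, X d := by
  rw [show Finset.Icc 1 M = Finset.Ico 1 (M + 1) from rfl, Finset.sum_Ico_eq_sum_range]
  simp only [Nat.add_sub_cancel, add_comm 1]

/-- `C(a+b, a) · b! / (a+b)! = 1/a!`. [folklore] -/
theorem choose_mul_factorial_div (a b : ℕ) :
    1 / ((a + b).factorial : ℝ) * ((a + b).choose a : ℝ) * (b.factorial : ℝ) = 1 / (a.factorial : ℝ) := by
  have h : ((a + b).choose a : ℝ) * a.factorial * b.factorial = (a + b).factorial := by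
    rw [Nat.choose_symm_add]
    exact_mod_cast Nat.add_choose_mul_factorial_mul_factorial a b
  have ha : (a.factorial : ℝ) ≠ 0 := by exact_mod_cast Nat.factorial_ne_zero a
  have hab : ((a + b).factorial : ℝ) ≠ 0 := by exact_mod_cast Nat.factorial_ne_zero _
  field_simp
  linarith [h]

section Tzero

variable {η γ : ℝ} {f : VecFn}

/-! ### The integrands and their bounds -/

/-- The Type-I integrand `u ↦ f(y,u)/(u₁⋯u_k)` is symmetric in `u` for `f ∈ 𝒮`.
[cite: FordMaynard2024PrimeSieves, Definition 6.1] -/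
theorem typeIIntegrand_comp_perm (hs : f.IsSymmetric) {r k : ℕ} (y : Fin r → ℝ)
    (σ : Equiv.Perm (Fin k)) (u : Fin k → ℝ) :
    f (r + k) (Fin.append y (u ∘ σ)) / ∏ i, (u ∘ σ) i = f (r + k) (Fin.append y u) / ∏ i, u i := by
  rw [hs.append_perm_right]
  congr 1
  exact Equiv.prod_comp σ u

/-- The Type-I integrand is measurable (for `f` measurable in each dimension). [folklore] -/
theorem measurable_typeIIntegrand (hfm : ∀ k, Measurable (f k)) {r k : ℕ} (y : Fin r → ℝ) :
    Measurable fun u : Fin k → ℝ => f (r + k) (Fin.append y u) / ∏ i, u i :=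
  ((hfm _).comp (measurable_append_right y)).div (Finset.measurable_prod _ fun i _ => measurable_pi_apply i)

/-- `u ↦ (N_{c₁}^{⋆i} ⋆ N_{c₂}^{⋆i'})_u(S)` is measurable. [folklore] -/
theorem measurable_sconv_spow_smallFn {k : ℕ} (c₁ c₂ : ℝ) (i i' : ℕ) (S : Finset (Fin k)) :
    Measurable fun u : Fin k → ℝ => sconv (spow (smallFn c₁ u) i) (spow (smallFn c₂ u) i') S :=
  measurable_sconv (measurable_spow (measurable_smallFn c₁) i)
    (measurable_spow (measurable_smallFn c₂) i') S

/-- `|(N_{c₁}^{⋆i} ⋆ N_{c₂}^{⋆i'})_u(S)| ≤ 2^k (2^k)^i (2^k)^{i'}`. [folklore] -/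
theorem abs_sconv_spow_smallFn_le {k : ℕ} (c₁ c₂ : ℝ) (i i' : ℕ) (u : Fin k → ℝ)
    (S : Finset (Fin k)) :
    |sconv (spow (smallFn c₁ u) i) (spow (smallFn c₂ u) i') S| ≤ 2 ^ k * ((2 ^ k) ^ i * (2 ^ k) ^ i') := by
  have h1 := abs_spow_le (F := smallFn c₁ u) zero_le_one (abs_smallFn_le c₁ u) i
  have h2 := abs_spow_le (F := smallFn c₂ u) zero_le_one (abs_smallFn_le c₂ u) i'
  simp only [Fintype.card_fin, mul_one] at h1 h2
  refine (abs_sconv_le h1 h2 S).trans ?_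
  have : (2 : ℝ) ^ S.card ≤ 2 ^ k := by
    refine pow_le_pow_right₀ (by norm_num) ?_
    exact (Finset.card_le_univ S).trans (by simp)
  exact mul_le_mul_of_nonneg_right this (by positivity)

/-- `|N_{u,c₁}(S) − N_{u,c₂}(S)| ≤ 2`. [folklore] -/
theorem abs_smallFn_sub_le {k : ℕ} (c₁ c₂ : ℝ) (u : Fin k → ℝ) (S : Finset (Fin k)) :
    |smallFn c₁ u S - smallFn c₂ u S| ≤ 2 := by
  have h1 := abs_smallFn_le c₁ u S
  have h2 := abs_smallFn_le c₂ u S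
  calc |smallFn c₁ u S - smallFn c₂ u S| ≤ |smallFn c₁ u S| + |smallFn c₂ u S| := abs_sub _ _
    _ ≤ 2 := by linarith

/-- The two-block integrand `F(u) P_u(S) M_u(S')` of `Φ_K(P ⋆ M)`: measurability. [folklore] -/
theorem measurable_twoBlockIntegrand (hfm : ∀ k, Measurable (f k)) {r k : ℕ} (y : Fin r → ℝ)
    (c : ℝ) (a₀ b₀ : ℕ) (S S' : Finset (Fin k)) :
    Measurable fun u : Fin k → ℝ => (f (r + k) (Fin.append y u) / ∏ i, u i) *
      (sconv (spow (smallFn c u) a₀) (spow (smallFn 2 u) b₀) S * (smallFn 2 u S' - smallFn c u S')) :=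
  (measurable_typeIIntegrand hfm y).mul ((measurable_sconv_spow_smallFn c 2 a₀ b₀ S).mul
    ((measurable_smallFn 2 S').sub (measurable_smallFn c S')))

/-- The two-block integrand: a uniform bound. [folklore] -/
theorem abs_twoBlockIntegrand_le (hf : MemTypeIStar η γ f) (hη : 0 < η) {Fb : ℝ}
    (hFb : ∀ k ξ, |f k ξ| ≤ Fb) {r k : ℕ} (y : Fin r → ℝ) (c : ℝ) (a₀ b₀ : ℕ) (S S' : Finset (Fin k))
    (u : Fin k → ℝ) :
    |(f (r + k) (Fin.append y u) / ∏ i, u i) *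
      (sconv (spow (smallFn c u) a₀) (spow (smallFn 2 u) b₀) S * (smallFn 2 u S' - smallFn c u S'))| ≤
      Fb / η ^ k * (2 ^ k * ((2 ^ k) ^ a₀ * (2 ^ k) ^ b₀) * 2) := by
  have hFb0 : 0 ≤ Fb := (abs_nonneg _).trans (hFb 0 Fin.elim0)
  rw [abs_mul, abs_mul]
  refine mul_le_mul (hf.abs_div_prod_le hη hFb y u) (mul_le_mul (abs_sconv_spow_smallFn_le c 2 a₀ b₀ u S)
    (abs_smallFn_sub_le 2 c u S') (abs_nonneg _) (by positivity)) (by positivity) (by positivity)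

/-! ### The boundary term `a = 0` and the diagonal term `b = 0` -/

/-- The `a = 0` term of the two-block expansion: `P(∅) = [i=0][i'=0]` and, on the slice
`Δ_k(w)` with `1 − γ ≤ w < 2`, `(N_2 − N_{1−γ})([k]) = 1`, so the term is `P(∅) · k! ·`(the `k`-th
term of (TypeI-f) at `y`). [cite: FordMaynard2024PrimeSieves, §6.1 (proof of Theorem 6.4)] -/
theorem twoBlock_zero_eq (γ : ℝ) (f : VecFn) {r k : ℕ} (hk : 1 ≤ k) (y : Fin r → ℝ)
    (hw1 : 1 - γ ≤ 1 - ∑ i, y i) (hw2 : 1 - ∑ i, y i < 2) (a₀ b₀ : ℕ) :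
    sliceIntegral k (1 - ∑ i, y i) (fun u => (f (r + k) (Fin.append y u) / ∏ i, u i) *
      (sconv (spow (smallFn (1 - γ) u) a₀) (spow (smallFn 2 u) b₀)
          (univ.filter fun i : Fin k => (i : ℕ) < 0) *
        (smallFn 2 u (univ \ univ.filter fun i : Fin k => (i : ℕ) < 0) -
          smallFn (1 - γ) u (univ \ univ.filter fun i : Fin k => (i : ℕ) < 0)))) =
      ((if a₀ = 0 then 1 else 0) * (if b₀ = 0 then 1 else 0)) *
        ((k.factorial : ℝ) * typeITerm f r y k) := by
  have h0 : (univ.filter fun i : Fin k => (i : ℕ) < 0) = ∅ := by ext i; simp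
  rw [h0, Finset.sdiff_empty]
  have hk' : (k.factorial : ℝ) ≠ 0 := by exact_mod_cast Nat.factorial_ne_zero k
  have htT : (k.factorial : ℝ) * typeITerm f r y k =
      sliceIntegral k (1 - ∑ i, y i) (fun u => f (r + k) (Fin.append y u) / ∏ i, u i) := by
    unfold typeITerm
    rw [← mul_assoc, mul_one_div_cancel hk', one_mul]
  rw [htT, ← sliceIntegral_const_mul]
  refine sliceIntegral_congr fun u _ hsum => ?_
  rw [sconv_spow_smallFn_empty, smallFn_univ_eq_one hk (by rw [hsum]; exact hw2),
    smallFn_eq_zero (by rw [hsum]; exact hw1)]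
  ring

/-- The diagonal term `b = 0` vanishes: the second block is empty and `(N_2 − N_c)(∅) = 0`.
[folklore] -/
theorem twoBlock_diag_eq_zero (γ : ℝ) (f : VecFn) {r : ℕ} (a : ℕ) (y : Fin r → ℝ) (w : ℝ)
    (a₀ b₀ : ℕ) :
    sliceIntegral (a + 0) w (fun u => (f (r + (a + 0)) (Fin.append y u) / ∏ i, u i) *
      (sconv (spow (smallFn (1 - γ) u) a₀) (spow (smallFn 2 u) b₀)
          (univ.filter fun i : Fin (a + 0) => (i : ℕ) < a) *
        (smallFn 2 u (univ \ univ.filter fun i : Fin (a + 0) => (i : ℕ) < a) -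
          smallFn (1 - γ) u (univ \ univ.filter fun i : Fin (a + 0) => (i : ℕ) < a)))) = 0 := by
  have h0 : (univ \ univ.filter fun i : Fin (a + 0) => (i : ℕ) < a) = ∅ := by
    ext i
    simp only [Finset.mem_sdiff, Finset.mem_univ, Finset.mem_filter, true_and, not_lt,
      Finset.notMem_empty, iff_false, not_le]
    have := i.2
    omega
  rw [h0]
  simp only [smallFn_empty, sub_zero, mul_zero]
  exact sliceIntegral_zero _ _

/-! ### The inner block: evaluation through (TypeI-f) -/

/-- **The inner integral of the two-block term.** For the first block `v ∈ ℝ^{a+1}` with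
`∑ v = t`, integrating the two-block integrand over the second block `z ∈ Δ_{b+1}(w − t)`
(`w = 1 − |y|`) gives `P(v)/∏v · 𝟙[1 − γ ≤ w − t] · (b+1)! ·`(the `(b+1)`-th term of (TypeI-f)
at `(y, v)`): the `P`-factor only sees the first block, the factor `N_2 − N_{1−γ}` of the second
block is `𝟙[its total ≥ 1 − γ]`, and `f(y,(v,z)) = f((y,v),z)`.
[cite: FordMaynard2024PrimeSieves, §6.1 (proof of Theorem 6.4)] -/
theorem twoBlock_inner_eq (hs : f.IsSymmetric) (γ : ℝ) {r : ℕ} (y : Fin r → ℝ)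
    (hy : ∀ i, 0 ≤ y i) (a b a₀ b₀ : ℕ) {t : ℝ} (ht : 0 < t) (v : Fin (a + 1) → ℝ)
    (hv : ∑ i, v i = t) :
    sliceIntegral (b + 1) (1 - ∑ i, y i - t) (fun z =>
      (f (r + (a + 1 + (b + 1))) (Fin.append y (Fin.append v z)) / ∏ i, Fin.append v z i) *
        (sconv (spow (smallFn (1 - γ) (Fin.append v z)) a₀) (spow (smallFn 2 (Fin.append v z)) b₀)
            (univ.filter fun i : Fin (a + 1 + (b + 1)) => (i : ℕ) < a + 1) *
          (smallFn 2 (Fin.append v z) (univ \ univ.filter fun i : Fin (a + 1 + (b + 1)) => (i : ℕ) < a + 1) -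
            smallFn (1 - γ) (Fin.append v z)
              (univ \ univ.filter fun i : Fin (a + 1 + (b + 1)) => (i : ℕ) < a + 1)))) =
      (sconv (spow (smallFn (1 - γ) v) a₀) (spow (smallFn 2 v) b₀) univ / ∏ i, v i) *
        (if 1 - γ ≤ 1 - ∑ i, y i - t then 1 else 0) *
        (((b + 1).factorial : ℝ) * typeITerm f (r + (a + 1)) (Fin.append y v) (b + 1)) := by
  -- the slice total of (TypeI-f) at `(y, v)`
  have hyv : 1 - ∑ i, Fin.append y v i = 1 - ∑ i, y i - t := by
    rw [Fin.sum_univ_add]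
    simp only [Fin.append_left, Fin.append_right, hv]
    ring
  have hfac : ((b + 1).factorial : ℝ) ≠ 0 := by exact_mod_cast Nat.factorial_ne_zero _
  have htT : ((b + 1).factorial : ℝ) * typeITerm f (r + (a + 1)) (Fin.append y v) (b + 1) =
      sliceIntegral (b + 1) (1 - ∑ i, y i - t)
        (fun z => f (r + (a + 1) + (b + 1)) (Fin.append (Fin.append y v) z) / ∏ i, z i) := by
    unfold typeITerm
    rw [hyv, ← mul_assoc, mul_one_div_cancel hfac, one_mul]
  rw [htT, ← sliceIntegral_const_mul]
  refine sliceIntegral_congr fun z _ hzsum => ?_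
  have hsum_y : 0 ≤ ∑ i, y i := Finset.sum_nonneg fun i _ => hy i
  -- the `P`-factor sees only `v`
  have hvz : (fun l : Fin (a + 1) => Fin.append v z (Fin.castAdd (b + 1) l)) = v :=
    funext fun l => Fin.append_left v z l
  have hP : sconv (spow (smallFn (1 - γ) (Fin.append v z)) a₀) (spow (smallFn 2 (Fin.append v z)) b₀)
      (univ.filter fun i : Fin (a + 1 + (b + 1)) => (i : ℕ) < a + 1) =
      sconv (spow (smallFn (1 - γ) v) a₀) (spow (smallFn 2 v) b₀) univ := by
    rw [filter_lt_eq_map_castAddEmb, sconv_spow_smallFn_castAdd, hvz]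
  -- the `M`-factor is the indicator of `1 - γ ≤ w - t`
  have hzv : (fun i : Fin (b + 1) => Fin.append v z (Fin.natAdd (a + 1) i)) = z :=
    funext fun i => Fin.append_right v z i
  have hN2 : smallFn 2 z univ = 1 :=
    smallFn_univ_eq_one (by omega) (by rw [hzsum]; linarith)
  have hNc : smallFn (1 - γ) z univ = if 1 - γ ≤ 1 - ∑ i, y i - t then 0 else 1 := by
    split_ifs with h
    · exact smallFn_eq_zero (by rw [hzsum]; exact h)
    · exact smallFn_univ_eq_one (by omega) (by rw [hzsum]; linarith)
  have hM : smallFn 2 (Fin.append v z) (univ \ univ.filter fun i : Fin (a + 1 + (b + 1)) => (i : ℕ) < a + 1) -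
      smallFn (1 - γ) (Fin.append v z) (univ \ univ.filter fun i : Fin (a + 1 + (b + 1)) => (i : ℕ) < a + 1) =
      if 1 - γ ≤ 1 - ∑ i, y i - t then 1 else 0 := by
    rw [sdiff_filter_lt_eq_map_natAddEmb, smallFn_natAdd, smallFn_natAdd, hzv, hN2, hNc]
    split_ifs <;> norm_num
  -- `f(y,(v,z)) = f((y,v),z)` and `∏ (v,z) = ∏ v ∏ z`
  have hf3 : f (r + (a + 1 + (b + 1))) (Fin.append y (Fin.append v z)) =
      f (r + (a + 1) + (b + 1)) (Fin.append (Fin.append y v) z) := by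
    rw [Fin.append_assoc]
    exact (hs.apply_comp_equiv (finCongr (Nat.add_assoc r (a + 1) (b + 1))) _).symm
  have hprod : ∏ i, Fin.append v z i = (∏ i, v i) * ∏ i, z i := by
    rw [Fin.prod_univ_add]
    simp only [Fin.append_left, Fin.append_right]
  rw [hP, hM, hf3, hprod]
  ring

/-! ### Interchanging the sum over the size of the second block with the integrals -/

/-- Finite sums over the size of the inner block commute with the outer integrals of the
two-block Fubini formula (bounded measurable integrands). [folklore] -/
theorem sum_integral_sliceIntegral_comm (a : ℕ) {w : ℝ} (hw : 0 < w) (s : Finset ℕ) (cc : ℕ → ℝ)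
    (G : (b : ℕ) → (Fin (a + 1 + (b + 1)) → ℝ) → ℝ) (hGm : ∀ b, Measurable (G b)) {C : ℕ → ℝ}
    (hC : ∀ b, 0 ≤ C b) (hGb : ∀ b x, |G b x| ≤ C b) :
    ∑ b ∈ s, cc b * ∫ t in Set.Ioc 0 w, sliceIntegral (a + 1) t
        (fun v => sliceIntegral (b + 1) (w - t) (fun z => G b (Fin.append v z))) =
      ∫ t in Set.Ioc 0 w, sliceIntegral (a + 1) t
        (fun v => ∑ b ∈ s, cc b * sliceIntegral (b + 1) (w - t) (fun z => G b (Fin.append v z))) := by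
  -- measurability of the inner parametric integrals
  have hm_inner : ∀ b, Measurable fun q : ℝ × (Fin (a + 1) → ℝ) =>
      cc b * sliceIntegral (b + 1) (w - q.1) (fun z => G b (Fin.append q.2 z)) := by
    intro b
    refine Measurable.const_mul ?_ _
    refine measurable_sliceIntegral_param (X := ℝ × (Fin (a + 1) → ℝ)) (b + 1)
      (w := fun q => w - q.1) (measurable_const.sub measurable_fst) ?_
    exact (hGm b).comp (measurable_finAppend.comp ((measurable_snd.comp measurable_fst).prodMk measurable_snd))
  -- a bound for them, for `t ∈ (0, w]`
  have hb_inner : ∀ b, ∀ t ∈ Set.Ioc (0 : ℝ) w, ∀ v : Fin (a + 1) → ℝ,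
      |cc b * sliceIntegral (b + 1) (w - t) (fun z => G b (Fin.append v z))| ≤ |cc b| * (C b * w ^ b) := by
    intro b t ht v
    rw [abs_mul]
    exact mul_le_mul_of_nonneg_left
      (abs_sliceIntegral_le' b hw.le (by linarith [ht.1]) (hC b) fun z => hGb b _) (abs_nonneg _)
  -- a bound for all `t`, `v`
  have hb_inner' : ∀ b t (v : Fin (a + 1) → ℝ),
      |cc b * sliceIntegral (b + 1) (w - t) (fun z => G b (Fin.append v z))| ≤
        |cc b| * (C b * max (|w| + |t|) 1 ^ b) := by
    intro b t v
    rw [abs_mul]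
    refine mul_le_mul_of_nonneg_left ?_ (abs_nonneg _)
    refine abs_sliceIntegral_le' b (zero_le_one.trans (le_max_right _ _)) ?_ (hC b) fun z => hGb b _
    calc w - t ≤ |w| + |t| := by linarith [le_abs_self w, neg_abs_le t]
      _ ≤ max (|w| + |t|) 1 := le_max_left _ _
  set B : ℝ → ℝ := fun t => ∑ b ∈ s, |cc b| * (C b * max (|w| + |t|) 1 ^ b) with hB
  have hBb : ∀ b ∈ s, ∀ t (v : Fin (a + 1) → ℝ),
      |cc b * sliceIntegral (b + 1) (w - t) (fun z => G b (Fin.append v z))| ≤ B t := by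
    intro b hb t v
    refine (hb_inner' b t v).trans ?_
    exact Finset.single_le_sum (f := fun b => |cc b| * (C b * max (|w| + |t|) 1 ^ b))
      (fun b _ => by have := hC b; positivity) hb
  -- additivity inside the outer slice integral
  have hadd : ∀ t, sliceIntegral (a + 1) t
      (fun v => ∑ b ∈ s, cc b * sliceIntegral (b + 1) (w - t) (fun z => G b (Fin.append v z))) =
      ∑ b ∈ s, sliceIntegral (a + 1) t
        (fun v => cc b * sliceIntegral (b + 1) (w - t) (fun z => G b (Fin.append v z))) :=
    fun t => sliceIntegral_finset_sum' s (a + 1) t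
      (fun b v => cc b * sliceIntegral (b + 1) (w - t) (fun z => G b (Fin.append v z)))
      (fun b _ => (hm_inner b).comp (measurable_const.prodMk measurable_id)) (C := B t)
      (fun b hb v => hBb b hb t v)
  rw [setIntegral_congr_fun measurableSet_Ioc (fun t _ => hadd t)]
  -- integrability of each outer integrand on `(0, w]`
  have hint : ∀ b ∈ s, IntegrableOn (fun t => sliceIntegral (a + 1) t
      (fun v => cc b * sliceIntegral (b + 1) (w - t) (fun z => G b (Fin.append v z))))
      (Set.Ioc 0 w) := by
    intro b _
    have hmeas : Measurable fun t => sliceIntegral (a + 1) t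
        (fun v => cc b * sliceIntegral (b + 1) (w - t) (fun z => G b (Fin.append v z))) :=
      measurable_sliceIntegral_param (X := ℝ) (a + 1) (w := fun t => t) measurable_id (hm_inner b)
    refine Measure.integrableOn_of_bounded (M := |cc b| * (C b * w ^ b) * w ^ a)
      measure_Ioc_lt_top.ne hmeas.aestronglyMeasurable ?_
    rw [ae_restrict_iff' measurableSet_Ioc]
    refine Filter.Eventually.of_forall fun t ht => ?_
    rw [Real.norm_eq_abs]
    exact abs_sliceIntegral_le' a hw.le ht.2 (by have := hC b; positivity) fun v => hb_inner b t ht v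
  rw [integral_finsetSum s hint]
  refine Finset.sum_congr rfl fun b _ => ?_
  rw [← integral_const_mul]
  refine setIntegral_congr_fun measurableSet_Ioc fun t _ => ?_
  rw [← sliceIntegral_const_mul]

/-! ### `Φ_K(P ⋆ (N_2 − N_{1−γ})) = 0` -/

/-- **The positive part of the two-block expansion vanishes by (TypeI-f).** For
`f ∈ 𝔉*_η(γ)`, `y ≥ η` with `|y| ≤ γ`, `w = 1 − |y|`, a first block of size `a+1 ≤ K` and
`K ≥ ⌊1/η⌋`: `∑_{b} 1/((a+1)!(b+1)!) ∫_{Δ_{a+b+2}(w)} f(y,u)/∏u · P_u(first block) ·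
(N_2 − N_{1−γ})_u(second block) du = 0` — after the two-block Fubini formula the inner integrals
are `P(v)/∏v · 𝟙[total ≥ 1−γ] ·`(Type-I terms at `(y,v)`), whose sum over `b` vanishes.
[cite: FordMaynard2024PrimeSieves, §6.1 (proof of Theorem 6.4)] -/
theorem twoBlock_pos_sum_eq_zero (hf : MemTypeIStar η γ f) (hη : 0 < η) (hγ1 : γ < 1)
    (hfm : ∀ k, Measurable (f k)) {Fb : ℝ} (hFb : ∀ k ξ, |f k ξ| ≤ Fb) {r : ℕ} (y : Fin r → ℝ)
    (hy : ∀ i, η ≤ y i) (hyγ : ∑ i, y i ≤ γ) (a₀ b₀ a : ℕ) {K : ℕ} (hK : maxBlock η ≤ K)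
    (haK : a + 1 ≤ K) :
    ∑ b ∈ Finset.range (K - (a + 1)),
      1 / ((a + 1 + (b + 1)).factorial : ℝ) * ((a + 1 + (b + 1)).choose (a + 1) : ℝ) *
        sliceIntegral (a + 1 + (b + 1)) (1 - ∑ i, y i) (fun u =>
          (f (r + (a + 1 + (b + 1))) (Fin.append y u) / ∏ i, u i) *
            (sconv (spow (smallFn (1 - γ) u) a₀) (spow (smallFn 2 u) b₀)
                (univ.filter fun i : Fin (a + 1 + (b + 1)) => (i : ℕ) < a + 1) *
              (smallFn 2 u (univ \ univ.filter fun i : Fin (a + 1 + (b + 1)) => (i : ℕ) < a + 1) -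
                smallFn (1 - γ) u (univ \ univ.filter fun i : Fin (a + 1 + (b + 1)) => (i : ℕ) < a + 1)))) = 0 := by
  have hFb0 : 0 ≤ Fb := (abs_nonneg _).trans (hFb 0 Fin.elim0)
  have hy0 : ∀ i, 0 ≤ y i := fun i => hη.le.trans (hy i)
  have hsum_y : 0 ≤ ∑ i, y i := Finset.sum_nonneg fun i _ => hy0 i
  set w : ℝ := 1 - ∑ i, y i with hw
  have hwpos : 0 < w := by rw [hw]; linarith
  -- the two-block integrands
  set G : (b : ℕ) → (Fin (a + 1 + (b + 1)) → ℝ) → ℝ := fun b u =>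
    (f (r + (a + 1 + (b + 1))) (Fin.append y u) / ∏ i, u i) *
      (sconv (spow (smallFn (1 - γ) u) a₀) (spow (smallFn 2 u) b₀)
          (univ.filter fun i : Fin (a + 1 + (b + 1)) => (i : ℕ) < a + 1) *
        (smallFn 2 u (univ \ univ.filter fun i : Fin (a + 1 + (b + 1)) => (i : ℕ) < a + 1) -
          smallFn (1 - γ) u (univ \ univ.filter fun i : Fin (a + 1 + (b + 1)) => (i : ℕ) < a + 1)))
    with hG
  set C : ℕ → ℝ := fun b => Fb / η ^ (a + 1 + (b + 1)) *
    (2 ^ (a + 1 + (b + 1)) * ((2 ^ (a + 1 + (b + 1))) ^ a₀ * (2 ^ (a + 1 + (b + 1))) ^ b₀) * 2) with hC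
  have hC0 : ∀ b, 0 ≤ C b := fun b => by positivity
  have hGm : ∀ b, Measurable (G b) := fun b => measurable_twoBlockIntegrand hfm y (1 - γ) a₀ b₀ _ _
  have hGb : ∀ b u, |G b u| ≤ C b := fun b u => abs_twoBlockIntegrand_le hf hη hFb y (1 - γ) a₀ b₀ _ _ u
  -- two-block Fubini
  have hsplit : ∀ b, sliceIntegral (a + 1 + (b + 1)) w (fun u =>
      (f (r + (a + 1 + (b + 1))) (Fin.append y u) / ∏ i, u i) *
        (sconv (spow (smallFn (1 - γ) u) a₀) (spow (smallFn 2 u) b₀)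
            (univ.filter fun i : Fin (a + 1 + (b + 1)) => (i : ℕ) < a + 1) *
          (smallFn 2 u (univ \ univ.filter fun i : Fin (a + 1 + (b + 1)) => (i : ℕ) < a + 1) -
            smallFn (1 - γ) u (univ \ univ.filter fun i : Fin (a + 1 + (b + 1)) => (i : ℕ) < a + 1)))) =
      ∫ t in Set.Ioc 0 w, sliceIntegral (a + 1) t
        (fun v => sliceIntegral (b + 1) (w - t) (fun z => G b (Fin.append v z))) := fun b =>
    sliceIntegral_append a b w (G b) (hGm b) (hC0 b) (hGb b)
  rw [Finset.sum_congr rfl fun b _ => by rw [hsplit b]]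
  rw [sum_integral_sliceIntegral_comm a hwpos _ _ G hGm hC0 hGb]
  -- the integrand vanishes identically
  have hzero : ∀ t ∈ Set.Ioc (0 : ℝ) w, sliceIntegral (a + 1) t (fun v =>
      ∑ b ∈ Finset.range (K - (a + 1)),
        1 / ((a + 1 + (b + 1)).factorial : ℝ) * ((a + 1 + (b + 1)).choose (a + 1) : ℝ) *
          sliceIntegral (b + 1) (w - t) (fun z => G b (Fin.append v z))) = 0 := by
    intro t ht
    rw [← sliceIntegral_zero (a + 1) t]
    refine sliceIntegral_congr fun v _ hv => ?_
    have hinner : ∀ b, sliceIntegral (b + 1) (w - t) (fun z => G b (Fin.append v z)) =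
        (sconv (spow (smallFn (1 - γ) v) a₀) (spow (smallFn 2 v) b₀) univ / ∏ i, v i) *
          (if 1 - γ ≤ w - t then 1 else 0) *
          (((b + 1).factorial : ℝ) * typeITerm f (r + (a + 1)) (Fin.append y v) (b + 1)) := fun b =>
      twoBlock_inner_eq hf.symm γ y hy0 a b a₀ b₀ ht.1 v hv
    simp only [hinner]
    have hcoef : ∀ b : ℕ, 1 / ((a + 1 + (b + 1)).factorial : ℝ) * ((a + 1 + (b + 1)).choose (a + 1) : ℝ) *
        ((sconv (spow (smallFn (1 - γ) v) a₀) (spow (smallFn 2 v) b₀) univ / ∏ i, v i) *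
          (if 1 - γ ≤ w - t then 1 else 0) *
          (((b + 1).factorial : ℝ) * typeITerm f (r + (a + 1)) (Fin.append y v) (b + 1))) =
        ((sconv (spow (smallFn (1 - γ) v) a₀) (spow (smallFn 2 v) b₀) univ / ∏ i, v i) *
          (if 1 - γ ≤ w - t then 1 else 0) * (1 / ((a + 1).factorial : ℝ))) *
          typeITerm f (r + (a + 1)) (Fin.append y v) (b + 1) := by
      intro b
      rw [← choose_mul_factorial_div (a + 1) (b + 1)]
      ring
    simp only [hcoef]
    rw [← Finset.mul_sum, sum_range_succ_shift]
    -- the Type-I partial sum at `(y, v)` vanishes, or the indicator does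
    by_cases hle : ∑ i, Fin.append y v i ≤ γ
    · rw [hf.sum_typeITerm_eq_zero hη (Fin.append y v) hle (by omega), mul_zero]
    · have : ¬ (1 - γ ≤ w - t) := by
        intro h
        apply hle
        rw [Fin.sum_univ_add]
        simp only [Fin.append_left, Fin.append_right, hv]
        rw [hw] at h
        linarith
      rw [if_neg this]
      ring
  rw [setIntegral_congr_fun measurableSet_Ioc hzero, integral_zero]

/-- **`Φ_K(P ⋆ (N_2 − N_{1−γ})) = 0`.** For `f ∈ 𝔉*_η(γ)` (measurable, bounded by `Fb`), `y ≥ η`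
with `|y| ≤ γ`, every product `P = N_{1−γ}^{⋆a₀} ⋆ N_2^{⋆b₀}` and `K ≥ ⌊1/η⌋`:
`∑_{k=1}^{K} (1/k!) ∫_{Δ_k(1−|y|)} f(y,u)/∏u · (P_u ⋆ (N_2 − N_{1−γ})_u)([k]) du = 0`.
[cite: FordMaynard2024PrimeSieves, §6.1 (proof of Theorem 6.4)] -/
theorem phi_sconv_sub_eq_zero (hf : MemTypeIStar η γ f) (hη : 0 < η) (hγ1 : γ < 1)
    (hfm : ∀ k, Measurable (f k)) {Fb : ℝ} (hFb : ∀ k ξ, |f k ξ| ≤ Fb) {r : ℕ} (y : Fin r → ℝ)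
    (hy : ∀ i, η ≤ y i) (hyγ : ∑ i, y i ≤ γ) (a₀ b₀ : ℕ) {K : ℕ} (hK : maxBlock η ≤ K) :
    ∑ k ∈ Finset.Icc 1 K, (1 / (k.factorial : ℝ)) * sliceIntegral k (1 - ∑ i, y i)
      (fun u => (f (r + k) (Fin.append y u) / ∏ i, u i) *
        sconv (sconv (spow (smallFn (1 - γ) u) a₀) (spow (smallFn 2 u) b₀))
          (fun S => smallFn 2 u S - smallFn (1 - γ) u S) univ) = 0 := by
  have hy0 : ∀ i, 0 ≤ y i := fun i => hη.le.trans (hy i)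
  have hsum_y : 0 ≤ ∑ i, y i := Finset.sum_nonneg fun i _ => hy0 i
  have hw1 : 1 - γ ≤ 1 - ∑ i, y i := by linarith
  have hw2 : 1 - ∑ i, y i < 2 := by linarith
  -- the two-block terms
  set J : ℕ → ℕ → ℝ := fun k a => sliceIntegral k (1 - ∑ i, y i) (fun u =>
    (f (r + k) (Fin.append y u) / ∏ i, u i) *
      (sconv (spow (smallFn (1 - γ) u) a₀) (spow (smallFn 2 u) b₀)
          (univ.filter fun i : Fin k => (i : ℕ) < a) *
        (smallFn 2 u (univ \ univ.filter fun i : Fin k => (i : ℕ) < a) -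
          smallFn (1 - γ) u (univ \ univ.filter fun i : Fin k => (i : ℕ) < a)))) with hJ
  -- Step 1: two-block symmetrisation in each dimension
  have hsym : ∀ k, sliceIntegral k (1 - ∑ i, y i)
      (fun u => (f (r + k) (Fin.append y u) / ∏ i, u i) *
        sconv (sconv (spow (smallFn (1 - γ) u) a₀) (spow (smallFn 2 u) b₀))
          (fun S => smallFn 2 u S - smallFn (1 - γ) u S) univ) =
      ∑ a ∈ Finset.range (k + 1), (k.choose a : ℝ) * J k a := by
    intro k
    rw [hJ]
    exact sliceIntegral_symm_sconv (1 - ∑ i, y i)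
      (F := fun u => f (r + k) (Fin.append y u) / ∏ i, u i)
      (typeIIntegrand_comp_perm hf.symm y)
      (P := fun u => sconv (spow (smallFn (1 - γ) u) a₀) (spow (smallFn 2 u) b₀))
      (Q := fun u S => smallFn 2 u S - smallFn (1 - γ) u S)
      (fun σ u S => sconv_spow_smallFn_comp_perm (1 - γ) 2 a₀ b₀ σ u S)
      (fun σ u S => smallFn_sub_comp_perm 2 (1 - γ) σ u S)
      (fun S S' => measurable_twoBlockIntegrand hfm y (1 - γ) a₀ b₀ S S')
      (fun S S' u => abs_twoBlockIntegrand_le hf hη hFb y (1 - γ) a₀ b₀ S S' u)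
  simp only [hsym]
  -- Step 2: the terms `a = 0` give `P(∅) ×` a partial sum of (TypeI-f) at `y`
  simp only [sum_range_succ_eq_add_sum_Icc, Nat.choose_zero_right, Nat.cast_one, one_mul, mul_add,
    Finset.sum_add_distrib]
  have hzero : ∑ k ∈ Finset.Icc 1 K, 1 / (k.factorial : ℝ) * J k 0 = 0 := by
    have : ∀ k ∈ Finset.Icc 1 K, 1 / (k.factorial : ℝ) * J k 0 =
        ((if a₀ = 0 then 1 else 0) * (if b₀ = 0 then 1 else 0)) * typeITerm f r y k := by
      intro k hk
      have hk1 : 1 ≤ k := (Finset.mem_Icc.1 hk).1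
      have hk' : (k.factorial : ℝ) ≠ 0 := by exact_mod_cast Nat.factorial_ne_zero k
      rw [hJ]
      dsimp only
      rw [twoBlock_zero_eq γ f hk1 y hw1 hw2 a₀ b₀]
      field_simp
    rw [Finset.sum_congr rfl this, ← Finset.mul_sum,
      hf.sum_typeITerm_eq_zero hη y hyγ (by omega), mul_zero]
  -- Step 3: the terms `a ≥ 1`, re-indexed by the sizes of the two blocks
  have hpos : ∑ k ∈ Finset.Icc 1 K, 1 / (k.factorial : ℝ) *
      ∑ a ∈ Finset.Icc 1 k, (k.choose a : ℝ) * J k a = 0 := by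
    have h1 : ∑ k ∈ Finset.Icc 1 K, 1 / (k.factorial : ℝ) *
        ∑ a ∈ Finset.Icc 1 k, (k.choose a : ℝ) * J k a =
        ∑ k ∈ Finset.Icc 1 K, ∑ a ∈ Finset.Icc 1 k, 1 / (k.factorial : ℝ) * (k.choose a : ℝ) * J k a := by
      refine Finset.sum_congr rfl fun k _ => ?_
      rw [Finset.mul_sum]
      exact Finset.sum_congr rfl fun a _ => by ring
    rw [h1, sum_Icc_sum_Icc_eq K (fun k a => 1 / (k.factorial : ℝ) * (k.choose a : ℝ) * J k a)]
    refine Finset.sum_eq_zero fun a ha => ?_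
    obtain ⟨a', rfl⟩ : ∃ a', a = a' + 1 := ⟨a - 1, by have := (Finset.mem_Icc.1 ha).1; omega⟩
    have haK : a' + 1 ≤ K := (Finset.mem_Icc.1 ha).2
    rw [Finset.sum_range_succ']
    have hdiag : J (a' + 1 + 0) (a' + 1) = 0 := by
      rw [hJ]
      exact twoBlock_diag_eq_zero γ f (a' + 1) y _ a₀ b₀
    rw [hdiag, mul_zero, add_zero, hJ]
    exact twoBlock_pos_sum_eq_zero hf hη hγ1 hfm hFb y hy hyγ a₀ b₀ a' hK haK
  rw [hzero, hpos, add_zero]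

/-! ### (Tzero) -/

/-- The expansion `𝓛_2(u) − 𝓛_{1−γ}(u) = ∑_{j ≤ K} w_j ∑_{i<j} ((N_c^{⋆i} ⋆ N_2^{⋆(j−1−i)}) ⋆ (N_2 − N_c))([k])`
for `u ∈ ℝ^k`, `k ≤ K` (terms with `j > k` vanish). [cite: FordMaynard2024PrimeSieves, §6.1 (proof of Theorem 6.4)] -/
theorem linnikFn_sub_eq_sum {k K : ℕ} (hkK : k ≤ K) (γ : ℝ) (u : Fin k → ℝ) :
    linnikFn 2 u univ - linnikFn (1 - γ) u univ =
      ∑ p ∈ (Finset.Icc 1 K).sigma (fun j => Finset.range j),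
        wLinnik p.1 * sconv (sconv (spow (smallFn (1 - γ) u) p.2) (spow (smallFn 2 u) (p.1 - 1 - p.2)))
          (fun S => smallFn 2 u S - smallFn (1 - γ) u S) univ := by
  have hterm : ∀ j, wLinnik j * spow (smallFn 2 u) j univ - wLinnik j * spow (smallFn (1 - γ) u) j univ =
      ∑ i ∈ Finset.range j, wLinnik j *
        sconv (sconv (spow (smallFn (1 - γ) u) i) (spow (smallFn 2 u) (j - 1 - i)))
          (fun S => smallFn 2 u S - smallFn (1 - γ) u S) univ := by
    intro j
    rw [← mul_sub, spow_sub_spow, Finset.mul_sum]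
  unfold linnikFn
  rw [Fintype.card_fin, ← Finset.sum_sub_distrib, Finset.sum_congr rfl fun j _ => hterm j,
    Finset.sum_sigma']
  -- extend the range of `j` from `k` to `K`
  refine Finset.sum_subset ?_ ?_
  · intro p hp
    simp only [Finset.mem_sigma, Finset.mem_Icc, Finset.mem_range] at hp ⊢
    omega
  · intro p hp hpk
    simp only [Finset.mem_sigma, Finset.mem_Icc, Finset.mem_range, not_and, not_lt] at hp hpk
    have hjk : k < p.1 := by
      by_contra h
      exact absurd (hpk ⟨hp.1.1, not_lt.1 h⟩) (not_le.2 hp.2)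
    rw [sconv_eq_zero_of_card_lt_add (a := p.2 + (p.1 - 1 - p.2)) (b := 1)
      (fun T hT => sconv_spow_smallFn_eq_zero_of_card_lt _ _ _ _ u hT)
      (fun T hT => by
        have hT' : T = ∅ := Finset.card_eq_zero.1 (by omega)
        subst hT'
        simp [smallFn_empty])
      (by rw [Finset.card_univ, Fintype.card_fin]; omega), mul_zero]

/-- **(Tzero): (TypeI-f) implies the one-block fragmentation identity.** Let `f ∈ 𝔉*_η(γ)`
(`0 < η`, `0 < γ < 1`) be measurable in each dimension. Then for every `y ∈ ℝ^r`, every `t` and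
every `K ≥ ⌊1/η⌋`,
`∑_{k=1}^{K} (1/k!) ∫_{u ∈ Δ_k(t)} (𝓛_2(u) − 𝓛_{1−γ}(u)) · f(y,u)/(u₁⋯u_k) du = 0`.
This is `T(y) = 0` of §6.1 (with `𝓛_2` for `𝓛_∞`; the terms `k > 1/η` vanish, and the identity
is trivial unless `y ≥ η`, `t = 1 − |y| ≥ 1 − γ`). [cite: FordMaynard2024PrimeSieves, §6.1 (Tzero)] -/
theorem MemTypeIStar.oneBlockFrag_eq_zero (hf : MemTypeIStar η γ f) (hη : 0 < η) (hγ1 : γ < 1)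
    (hfm : ∀ k, Measurable (f k)) {r : ℕ} (y : Fin r → ℝ) (t : ℝ) {K : ℕ} (hK : maxBlock η ≤ K) :
    ∑ k ∈ Finset.Icc 1 K, (1 / (k.factorial : ℝ)) * sliceIntegral k t (fun u =>
      (linnikFn 2 u univ - linnikFn (1 - γ) u univ) * (f (r + k) (Fin.append y u) / ∏ i, u i)) = 0 := by
  obtain ⟨Fb, hFb⟩ := hf.bounded
  have hFb0 : 0 ≤ Fb := (abs_nonneg _).trans (hFb 0 Fin.elim0)
  -- Case 1: a component of `y` below `η`: `f(y, ·) ≡ 0`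
  by_cases hy : ∀ i, η ≤ y i
  swap
  · push Not at hy
    obtain ⟨i, hi⟩ := hy
    refine Finset.sum_eq_zero fun k _ => ?_
    have : (fun u : Fin k → ℝ => (linnikFn 2 u univ - linnikFn (1 - γ) u univ) *
        (f (r + k) (Fin.append y u) / ∏ i, u i)) = fun _ => 0 := by
      funext u
      have hz : f (r + k) (Fin.append y u) = 0 := by
        by_contra h
        have := (hf.support _ _ h).1 (Fin.castAdd k i)
        rw [Fin.append_left] at this
        linarith
      rw [hz, zero_div, mul_zero]
    rw [this, sliceIntegral_zero, mul_zero]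
  have hy0 : ∀ i, 0 ≤ y i := fun i => hη.le.trans (hy i)
  have hsum_y : 0 ≤ ∑ i, y i := Finset.sum_nonneg fun i _ => hy0 i
  -- Case 2: the slice total is not `1 - |y|`: `f(y, ·) ≡ 0` on the slice
  by_cases ht : t = 1 - ∑ i, y i
  swap
  · refine Finset.sum_eq_zero fun k _ => ?_
    have : sliceIntegral k t (fun u => (linnikFn 2 u univ - linnikFn (1 - γ) u univ) *
        (f (r + k) (Fin.append y u) / ∏ i, u i)) = sliceIntegral k t (fun _ => 0) := by
      refine sliceIntegral_congr fun u _ hsum => ?_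
      have hz : f (r + k) (Fin.append y u) = 0 := by
        by_contra h
        have h1 := (hf.support _ _ h).2
        rw [Fin.sum_univ_add] at h1
        simp only [Fin.append_left, Fin.append_right, hsum] at h1
        exact ht (by linarith)
      rw [hz, zero_div, mul_zero]
    rw [this, sliceIntegral_zero, mul_zero]
  subst ht
  -- Case 3: `|y| > γ`: the slice total is `< 1 - γ` and `𝓛_2 = 𝓛_{1-γ}` on the slice
  by_cases hyγ : ∑ i, y i ≤ γ
  swap
  · refine Finset.sum_eq_zero fun k hk => ?_
    have hk1 : 1 ≤ k := (Finset.mem_Icc.1 hk).1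
    have : sliceIntegral k (1 - ∑ i, y i) (fun u => (linnikFn 2 u univ - linnikFn (1 - γ) u univ) *
        (f (r + k) (Fin.append y u) / ∏ i, u i)) = sliceIntegral k (1 - ∑ i, y i) (fun _ => 0) := by
      refine sliceIntegral_congr fun u hu hsum => ?_
      have hne : (univ : Finset (Fin k)).Nonempty := Finset.univ_nonempty_iff.2 ⟨⟨0, hk1⟩⟩
      have hu0 : ∀ i ∈ (univ : Finset (Fin k)), 0 ≤ u i := fun i _ => (hu i).le
      rw [linnikFn_eq_of_sum_lt 2 u hne hu0 (by rw [hsum]; linarith),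
        linnikFn_eq_of_sum_lt (1 - γ) u hne hu0 (by rw [hsum]; linarith), sub_self, zero_mul]
    rw [this, sliceIntegral_zero, mul_zero]
  -- Case 4: the main case
  -- the expansion of `𝓛_2 − 𝓛_{1-γ}` and linearity
  set Idx : Finset ((_ : ℕ) × ℕ) := (Finset.Icc 1 K).sigma (fun j => Finset.range j) with hIdx
  have hexp : ∀ k ∈ Finset.Icc 1 K, (fun u : Fin k → ℝ => (linnikFn 2 u univ - linnikFn (1 - γ) u univ) *
      (f (r + k) (Fin.append y u) / ∏ i, u i)) = fun u => ∑ p ∈ Idx, wLinnik p.1 *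
        ((f (r + k) (Fin.append y u) / ∏ i, u i) *
          sconv (sconv (spow (smallFn (1 - γ) u) p.2) (spow (smallFn 2 u) (p.1 - 1 - p.2)))
            (fun S => smallFn 2 u S - smallFn (1 - γ) u S) univ) := by
    intro k hk
    funext u
    rw [linnikFn_sub_eq_sum (Finset.mem_Icc.1 hk).2 γ u, Finset.sum_mul]
    exact Finset.sum_congr rfl fun p _ => by ring
  -- measurability and bounds of the summands
  have hmeas : ∀ k (p : (_ : ℕ) × ℕ), Measurable fun u : Fin k → ℝ => wLinnik p.1 *
      ((f (r + k) (Fin.append y u) / ∏ i, u i) *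
        sconv (sconv (spow (smallFn (1 - γ) u) p.2) (spow (smallFn 2 u) (p.1 - 1 - p.2)))
          (fun S => smallFn 2 u S - smallFn (1 - γ) u S) univ) := by
    intro k p
    refine Measurable.const_mul ((measurable_typeIIntegrand hfm y).mul ?_) _
    exact measurable_sconv (F := fun u => sconv (spow (smallFn (1 - γ) u) p.2) (spow (smallFn 2 u) (p.1 - 1 - p.2)))
      (G := fun u S => smallFn 2 u S - smallFn (1 - γ) u S)
      (fun B => measurable_sconv_spow_smallFn _ _ _ _ B)
      (fun B => (measurable_smallFn 2 B).sub (measurable_smallFn _ B)) univ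
  have hbound : ∀ k, ∀ p ∈ Idx, ∀ u : Fin k → ℝ, |wLinnik p.1 *
      ((f (r + k) (Fin.append y u) / ∏ i, u i) *
        sconv (sconv (spow (smallFn (1 - γ) u) p.2) (spow (smallFn 2 u) (p.1 - 1 - p.2)))
          (fun S => smallFn 2 u S - smallFn (1 - γ) u S) univ)| ≤
      Fb / η ^ k * (2 ^ k * ((2 ^ k * ((2 ^ k) ^ K * (2 ^ k) ^ K)) * 2)) := by
    intro k p hp u
    have hp' : p.2 ≤ K ∧ p.1 - 1 - p.2 ≤ K := by
      simp only [hIdx, Finset.mem_sigma, Finset.mem_Icc, Finset.mem_range] at hp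
      omega
    have h2k : (1 : ℝ) ≤ 2 ^ k := one_le_pow₀ (by norm_num)
    have hP : ∀ B, |sconv (spow (smallFn (1 - γ) u) p.2) (spow (smallFn 2 u) (p.1 - 1 - p.2)) B| ≤
        2 ^ k * ((2 ^ k) ^ K * (2 ^ k) ^ K) := by
      intro B
      refine (abs_sconv_spow_smallFn_le _ _ _ _ u B).trans ?_
      refine mul_le_mul_of_nonneg_left (mul_le_mul (pow_le_pow_right₀ h2k hp'.1)
        (pow_le_pow_right₀ h2k hp'.2) (by positivity) (by positivity)) (by positivity)
    have hPM := abs_sconv_le hP (fun B => abs_smallFn_sub_le 2 (1 - γ) u B) univ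
    rw [Finset.card_univ, Fintype.card_fin] at hPM
    rw [abs_mul, abs_mul]
    calc |wLinnik p.1| * (|f (r + k) (Fin.append y u) / ∏ i, u i| *
        |sconv (sconv (spow (smallFn (1 - γ) u) p.2) (spow (smallFn 2 u) (p.1 - 1 - p.2)))
          (fun S => smallFn 2 u S - smallFn (1 - γ) u S) univ|)
        ≤ 1 * (Fb / η ^ k * (2 ^ k * ((2 ^ k * ((2 ^ k) ^ K * (2 ^ k) ^ K)) * 2))) :=
          mul_le_mul (abs_wLinnik_le _) (mul_le_mul (hf.abs_div_prod_le hη hFb y u) hPM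
            (abs_nonneg _) (by positivity)) (by positivity) zero_le_one
      _ = _ := one_mul _
  -- rewrite every slice integral as a sum over `Idx`
  have hlin : ∀ k ∈ Finset.Icc 1 K, sliceIntegral k (1 - ∑ i, y i) (fun u =>
      (linnikFn 2 u univ - linnikFn (1 - γ) u univ) * (f (r + k) (Fin.append y u) / ∏ i, u i)) =
      ∑ p ∈ Idx, wLinnik p.1 * sliceIntegral k (1 - ∑ i, y i) (fun u =>
        (f (r + k) (Fin.append y u) / ∏ i, u i) *
          sconv (sconv (spow (smallFn (1 - γ) u) p.2) (spow (smallFn 2 u) (p.1 - 1 - p.2)))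
            (fun S => smallFn 2 u S - smallFn (1 - γ) u S) univ) := by
    intro k hk
    rw [hexp k hk, sliceIntegral_finset_sum' Idx k _ _ (fun p _ => hmeas k p) (fun p hp u => hbound k p hp u)]
    refine Finset.sum_congr rfl fun p _ => ?_
    rw [← sliceIntegral_const_mul]
  rw [Finset.sum_congr rfl fun k hk => by rw [hlin k hk]]
  simp_rw [Finset.mul_sum]
  rw [Finset.sum_comm]
  refine Finset.sum_eq_zero fun p _ => ?_
  have : ∀ k ∈ Finset.Icc 1 K, 1 / (k.factorial : ℝ) * (wLinnik p.1 *
      sliceIntegral k (1 - ∑ i, y i) (fun u => (f (r + k) (Fin.append y u) / ∏ i, u i) *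
        sconv (sconv (spow (smallFn (1 - γ) u) p.2) (spow (smallFn 2 u) (p.1 - 1 - p.2)))
          (fun S => smallFn 2 u S - smallFn (1 - γ) u S) univ)) =
      wLinnik p.1 * (1 / (k.factorial : ℝ) *
        sliceIntegral k (1 - ∑ i, y i) (fun u => (f (r + k) (Fin.append y u) / ∏ i, u i) *
          sconv (sconv (spow (smallFn (1 - γ) u) p.2) (spow (smallFn 2 u) (p.1 - 1 - p.2)))
            (fun S => smallFn 2 u S - smallFn (1 - γ) u S) univ)) := fun k _ => by ring
  rw [Finset.sum_congr rfl this, ← Finset.mul_sum,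
    phi_sconv_sub_eq_zero hf hη hγ1 hfm hFb y hy hyγ p.2 (p.1 - 1 - p.2) hK, mul_zero]

end Tzero

end Literature.NumberTheory.Sieve.FordMaynard
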